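import Summits.QuantumFields.BalabanUV.Beta.EriceRemainderEnclosureHistoryAutonomyComparisonNonlinearGaugeDefect
import Summits.QuantumFields.BalabanUV.Beta.EriceRemainderEnclosureHistoryAutonomyComparisonNonlinearVariationPrep
import Summits.QuantumFields.BalabanUV.Beta.EriceRemainderEnclosureHistoryAutonomyComparisonNonlinearVariationBase

/-!
# EriceRemainderEnclosureHistoryAutonomyComparisonNonlinearSize — (E121e) **COMPARISON AT ANY STEEPNESS FOR EVERY ISOTONE EXCESS OF SMALL SIZE.**  `B u = β₀ + Σ_{k<K} L_k·u_k`
# (`β₀ > 0`, `L ≥ 0`, `L_0 = 0`; the profile, the range `K` and all sizes ARBITRARY — no light-row condition); `B′ ≥ B` on the box with a modulus `M′`, the EXCESS `E = B′ − B`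
# ISOTONE and of SIZE **`E ≤ β₀∕10`** — NO modulus ∕ steepness condition on `E` (the dual of (E119d) `le_of_small_modulus_excess`: there `ME·γ ≤ β₀∕5` with the size
# free, here the size `≤ β₀∕10` with the modulus free).  Then: (**`steps_nonneg_gauge_size`**) along every base orbit `h = S y` the step quantities `X_m = B′(S′h_m) − B(S h_m)`
# are NON-NEGATIVE, the gauge quantity `G_m = X_m·h_m²` is NON-INCREASING in the depth, AND `G_m ≥ Σ_{j<J} h_{m+j}²·(e_{m+j} − e_{m+j+1})` for every `J` (the VARIATION BOUND);
# (**`effective_le_size`**) `B(S y) ≤ B′(S′y)` at every pin; (**`le_of_small_isotone_excess`**, family-free) ANY box solutions `h`, `h′` of `B`, `B′` from one pin satisfy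
# `h′ ≤ h` at EVERY scale.
#
# THE PROOF is the level-gauge row induction of (E118e)∕(E119d)∕(E120c) with three changes.  (1) The per-age damping defect of configuration `n+1` is (E121a)
# `conf_incr_ge_var`: `θ_k = F(n+k+1) + e_{n+k+1}·h_{n+k+1}²` — it needs the variation bound at the deeper row `n+k+1`, which is part of the induction hypothesis.
# (2) The extra `e·h²` is priced by the spare twentieth ((E121b) `defect_size_le`, `e ≤ β₀∕10`) in the generic step (E121d) `gauge_step_of_defect`, whose conclusion KEEPS
# the excess difference: `G_{n+1} + (e_n − e_{n+1})·h_n² ≤ G_n`; telescoping it gives the variation bound at row `n`.  (3) Base = the deep region of (E121b)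
# `exists_base_depth_var`: `X ≥ 0` by the small-pin estimate (E49j)(1), the gauge by (E120b) `base_gauge_light` (deep rows are light), the variation bound by (E121b)
# `var_base`.

Cell `pub-balaban`, β-function sub-cell, BINDER row D4 «RemainderConst leaves for Bałaban's split» (`HOME/BINDER-OWNERS.md`; owner lineage `b2b-balaban-beta-an4`;
this file by co-owner #2 lineage `b2b-balaban-beta-d4-p2`, generation 99), β-FLOW TEAM duty (1), FREEZE (0) honoured (def-free; imports (E121a∕b∕d); uses (E118a)
`affine_facts`, (E119b) `excess_facts` ∕ `cmp_of_steps_nonneg` ∕ `excess_orbit_antitone`, (E120b) `base_gauge_light`, (E121a) `conf_incr_ge_var`, (E121b) `defect_size_le` ∕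
`exists_base_depth_var` ∕ `var_base`, (E121d) `gauge_step_of_defect`, (E49j) `effective_le_of_small_pin`, (E49k) `family_le_of_orbit`, (E39) `exists_memFlow_zm`, (E43b)
`memFlow_unique_of_monotone_zm`, (E48a) `family_mem` ∕ `family_zero` ∕ `le_of_pin_le` BY NAME; §2–§3 are (E119d)'s proofs re-run — nothing else restated).

HONEST FRAMING (page 1, verbatim and binding).  *"Discharging BetaPertH makes Bałaban's UV stability UNCONDITIONAL — a real constructive-QFT result; it is
NOT the continuum limit and NOT the Clay problem."*  THIS FILE DISCHARGES NOTHING OF THE KIND.  Elementary real analysis about ABSTRACT functionals on a box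
]0,γ]^ℕ with displayed floors, moduli, profiles and signs — hypotheses of a census, not facts; the form, signs, ages and moments of Bałaban's (1.22) limit
functional are NOT PRINTED ([I] p. 298; GAPS G-t4-U2-1∕-2) and NOT asserted.  Row D4 class UNCHANGED (critical-path width 0; instance 0∕1; D4 DISCHARGE NO
DATE).  HONEST DEPENDENCY: continuum YM on T⁴ ⇐ BetaPertH ∧ nine spine estimates (0/9 proved); BetaPertH ⇐ (D1) ∧ (D4) ∧ CAP+tail; G-an2-4 gates asym, D1
and NE2/3/4.  NOT CLAIMED: excesses of size `> β₀∕10` without a modulus or light-row condition, Markov weight `L_0 > 0`, anything printed — NOT B12 Thm 2, NOT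
BetaPertH, NOT continuum, NOT Clay.

WHAT IS PROVED ([folklore]; 0 `def`, 0 sorry).  §1 `excess_le_head`, **`gauge_step_size`**.  §2 **`steps_nonneg_gauge_size`**.  §3 **`effective_le_size`**,
**`le_of_small_isotone_excess`**.
-/

noncomputable section
open Finset Set

namespace Summit.QuantumFields.BalabanUV.Beta.EriceRemainderEnclosureHistoryAutonomyComparisonNonlinearSize

open Literature.MathematicalPhysics.QuantumFieldTheory.Balaban1983to89
open Literature.MathematicalPhysics.QuantumFieldTheory.Balaban1983to89.T4BetaStationary
open Literature.MathematicalPhysics.QuantumFieldTheory.Balaban1983to89.T4BetaFlowWellPosed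
open Summit.QuantumFields.BalabanUV.Beta.EriceRemainderEnclosureHistoryAutonomyOrder (family_mem family_zero le_of_pin_le)
open Summit.QuantumFields.BalabanUV.Beta.EriceRemainderEnclosureHistoryAutonomyComparisonExcess (effective_le_of_small_pin)
open Summit.QuantumFields.BalabanUV.Beta.EriceRemainderEnclosureHistoryAutonomyComparisonIsotoneExcess (family_le_of_orbit)
open Summit.QuantumFields.BalabanUV.Beta.EriceRemainderEnclosureHistoryAutonomyExistence (exists_memFlow_zm)
open Summit.QuantumFields.BalabanUV.Beta.EriceRemainderEnclosureHistoryAutonomyMonotoneGeneral (memFlow_unique_of_monotone_zm)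
open Summit.QuantumFields.BalabanUV.Beta.EriceRemainderEnclosureHistoryAutonomyComparisonNonlinearRowPrep (affine_facts)
open Summit.QuantumFields.BalabanUV.Beta.EriceRemainderEnclosureHistoryAutonomyComparisonNonlinearModulusPrep
  (excess_facts cmp_of_steps_nonneg excess_orbit_antitone)
open Summit.QuantumFields.BalabanUV.Beta.EriceRemainderEnclosureHistoryAutonomyComparisonNonlinearLightBase (base_gauge_light)
open Summit.QuantumFields.BalabanUV.Beta.EriceRemainderEnclosureHistoryAutonomyComparisonNonlinearVariationPrep (conf_incr_ge_var)
open Summit.QuantumFields.BalabanUV.Beta.EriceRemainderEnclosureHistoryAutonomyComparisonNonlinearVariationBase (defect_size_le exists_base_depth_var var_base)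
open Summit.QuantumFields.BalabanUV.Beta.EriceRemainderEnclosureHistoryAutonomyComparisonNonlinearGaugeDefect (gauge_step_of_defect)

variable {B B' : (ℕ → ℝ) → ℝ} {γ β₀ M' : ℝ} {L : ℕ → ℝ} {K : ℕ} {S S' : ℝ → ℕ → ℝ}

/-! ## §1 The step of the row induction -/

/-- Along the base orbit the excess at the configurations' pins is at most its value at the head: `0 ≤ e_i ≤ e_0 = E(S′y)` ((E119b) `excess_orbit_antitone`). [folklore] -/
theorem excess_le_head (hBaff : ∀ u, SeqBox γ u → B u = β₀ + ∑ k ∈ range K, L k * u k) (hL : ∀ k, 0 ≤ L k) (hβ : 0 < β₀)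
    (hB' : ∀ u u' : ℕ → ℝ, SeqBox γ u → SeqBox γ u' → ∀ D : ℝ, (∀ j, |u j - u' j| ≤ D) → |B' u - B' u'| ≤ M' * D) (hM' : 0 ≤ M')
    (hexc : ∀ u, SeqBox γ u → B u ≤ B' u)
    (hDmono : ∀ u v : ℕ → ℝ, SeqBox γ u → SeqBox γ v → (∀ j, u j ≤ v j) → B' u - B u ≤ B' v - B v)
    (hS : ∀ p, 0 < p → p ≤ γ → SeqBox γ (S p) ∧ MemFlow B p (S p))
    (hS' : ∀ p, 0 < p → p ≤ γ → SeqBox γ (S' p) ∧ MemFlow B' p (S' p))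
    (huniq' : ∀ p, 0 < p → p ≤ γ → ∀ u u' : ℕ → ℝ, SeqBox γ u → SeqBox γ u' → MemFlow B' p u → MemFlow B' p u' → u = u')
    {y : ℝ} (hy : 0 < y) (hyγ : y ≤ γ) (i : ℕ) :
    0 ≤ B' (S' (S y i)) - B (S' (S y i)) ∧ B' (S' (S y i)) - B (S' (S y i)) ≤ B' (S' y) - B (S' y) := by
  have hq := family_mem hS hy hyγ i
  refine ⟨by linarith [hexc _ (hS' _ hq.1 hq.2).1], ?_⟩
  have hchain : ∀ d, B' (S' (S y (0 + d))) - B (S' (S y (0 + d))) ≤ B' (S' (S y 0)) - B (S' (S y 0)) := by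
    intro d
    induction d with
    | zero => simp
    | succ d ih =>
      have := (excess_orbit_antitone hBaff hL hβ hB' hM' hexc hDmono hS hS' huniq' hy hyγ (0 + d)).2
      rw [show 0 + (d + 1) = 0 + d + 1 by ring]
      exact this.trans ih
  have := hchain i
  rwa [zero_add, family_zero hS hy hyγ] at this

set_option maxHeartbeats 800000 in
/-- **THE STEP OF THE ROW INDUCTION (isotone excess of size `≤ β₀∕10`, any steepness).**  If `X_m ≥ 0` and `G_{m+1} ≤ G_m` for `m ≥ n+1`, and the variation bound
`Σ_{j<J} h_{m+j}²·Δe_{m+j} ≤ G_m` holds for `m ≥ n+2` and every `J`, then `G_{n+1} + (e_n − e_{n+1})·h_n² ≤ G_n` ((E121d) `gauge_step_of_defect` with (E121a)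
`conf_incr_ge_var` and (E121b) `defect_size_le`). [folklore] -/
theorem gauge_step_size (hBaff : ∀ u, SeqBox γ u → B u = β₀ + ∑ k ∈ range K, L k * u k) (hL : ∀ k, 0 ≤ L k) (hL0 : L 0 = 0) (hβ : 0 < β₀)
    (hB' : ∀ u u' : ℕ → ℝ, SeqBox γ u → SeqBox γ u' → ∀ D : ℝ, (∀ j, |u j - u' j| ≤ D) → |B' u - B' u'| ≤ M' * D) (hM' : 0 ≤ M')
    (hexc : ∀ u, SeqBox γ u → B u ≤ B' u)
    (hDmono : ∀ u v : ℕ → ℝ, SeqBox γ u → SeqBox γ v → (∀ j, u j ≤ v j) → B' u - B u ≤ B' v - B v)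
    (hS : ∀ p, 0 < p → p ≤ γ → SeqBox γ (S p) ∧ MemFlow B p (S p))
    (huniq : ∀ p, 0 < p → p ≤ γ → ∀ u u' : ℕ → ℝ, SeqBox γ u → SeqBox γ u' → MemFlow B p u → MemFlow B p u' → u = u')
    (hS' : ∀ p, 0 < p → p ≤ γ → SeqBox γ (S' p) ∧ MemFlow B' p (S' p))
    (huniq' : ∀ p, 0 < p → p ≤ γ → ∀ u u' : ℕ → ℝ, SeqBox γ u → SeqBox γ u' → MemFlow B' p u → MemFlow B' p u' → u = u')
    {y : ℝ} (hy : 0 < y) (hyγ : y ≤ γ) (hEsize : B' (S' y) - B (S' y) ≤ β₀ / 10) (n : ℕ)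
    (hX : ∀ m, n + 1 ≤ m → 0 ≤ B' (S' (S y m)) - B (S (S y m)))
    (hg : ∀ m, n + 1 ≤ m → (B' (S' (S y (m + 1))) - B (S (S y (m + 1)))) * S y (m + 1) ^ 2 ≤ (B' (S' (S y m)) - B (S (S y m))) * S y m ^ 2)
    (hV : ∀ m, n + 2 ≤ m → ∀ J, ∑ j ∈ range J, S y (m + j) ^ 2
        * ((B' (S' (S y (m + j))) - B (S' (S y (m + j)))) - (B' (S' (S y (m + j + 1))) - B (S' (S y (m + j + 1)))))
        ≤ (B' (S' (S y m)) - B (S (S y m))) * S y m ^ 2) :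
    (B' (S' (S y (n + 1))) - B (S (S y (n + 1)))) * S y (n + 1) ^ 2
        + ((B' (S' (S y n)) - B (S' (S y n))) - (B' (S' (S y (n + 1))) - B (S' (S y (n + 1))))) * S y n ^ 2
      ≤ (B' (S' (S y n)) - B (S (S y n))) * S y n ^ 2 := by
  obtain ⟨hmono, hlo, _, _⟩ := affine_facts hBaff hL hβ
  have hh := (hS y hy hyγ).1
  have hf := (hS y hy hyγ).2
  have hpos : ∀ j, 0 < S y j := fun j => (hh j).1
  have hcmp := cmp_of_steps_nonneg hBaff hL hβ hB' hM' hexc hDmono hS huniq hS' huniq' hy hyγ n hX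
  set e : ℕ → ℝ := fun i => B' (S' (S y i)) - B (S' (S y i)) with he_def
  have he := fun i => excess_le_head hBaff hL hβ hB' hM' hexc hDmono hS hS' huniq' hy hyγ i
  -- the defect data
  set ξ : ℕ → ℝ := fun k => e (n + k + 1) * S y (n + k + 1) ^ 2 with hξ_def
  set θ : ℕ → ℝ := fun k => ∑ q ∈ Ico 1 K, L q * S y (n + k + 1 + q) ^ 3 / 2 + ξ k with hθ_def
  have hθ0 : ∀ k, 0 ≤ θ k := fun k => by
    have h1 : 0 ≤ ∑ q ∈ Ico 1 K, L q * S y (n + k + 1 + q) ^ 3 / 2 :=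
      sum_nonneg fun q _ => by have := hL q; have := hpos (n + k + 1 + q); positivity
    have h2 : 0 ≤ ξ k := mul_nonneg (he (n + k + 1)).1 (sq_nonneg _)
    simp only [hθ_def]; linarith
  have hdef : ∀ j, j + 1 < K → (1 / S' (S y (n + 1)) j ^ 2 - 1 / S y (n + 1 + j) ^ 2)
      - (1 / S' (S y (n + 1)) (j + 1) ^ 2 - 1 / S y (n + 1 + j + 1) ^ 2)
      ≤ θ (j + 1) * (1 / S' (S y (n + 1)) j ^ 2 - 1 / S y (n + 1 + j) ^ 2) := by
    intro j _
    have h := conf_incr_ge_var hBaff hL hL0 hβ hB' hM' hexc hDmono hS huniq hS' huniq' hy hyγ (n + 1) j (hcmp (n + 1) (by omega))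
      (hcmp (n + 1 + 1 + j) (by omega)) (hV (n + 1 + 1 + j) (by omega))
    rw [show n + 1 + 1 + j = n + (j + 1) + 1 by ring] at h
    exact h
  have hθle : ∀ k, 2 ≤ k → k < K → θ k ≤ ∑ q ∈ Ico 1 K, L q * S y (n + k + 1 + q) ^ 3 / 2 + ξ k := fun k _ _ => le_rfl
  have hprice : ∀ k, 2 ≤ k → k < K → ∀ W : ℝ, 0 ≤ W →
      W ≤ (B' (S' (S y (n + 1))) - B (S (S y (n + 1)))) * S y (n + 1) ^ 2 * ∑ l ∈ Ico 1 k, 1 / S y (n + 1 + l) ^ 2 →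
      L k * S y (n + 1 + k) ^ 3 / 2 * ξ k * W ≤ 1 / 20 * (L k * S y (n + 1 + k) * S y (n + 1) ^ 2 * (B' (S' (S y (n + 1))) - B (S (S y (n + 1))))) := by
    intro k hk2 _ W _ hW
    exact defect_size_le (B := B) (L := L) hL hβ hlo hh hf (he (n + k + 1)).1 ((he (n + k + 1)).2.trans hEsize) n (by omega) (hX (n + 1) le_rfl) hW
  exact gauge_step_of_defect hBaff hL hβ hB' hM' hexc hDmono hS huniq hS' huniq' hy hyγ n hX hg hθ0 hdef hθle hprice

/-! ## §2 The nonlinear level gauge and the variation bound along every orbit -/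

/-- **THE NONLINEAR LEVEL GAUGE FOR AN ISOTONE EXCESS OF SIZE `≤ β₀∕10`.**  Base affine (any profile, range, size; `L_0 = 0`); `B′ ≥ B` with modulus `M′`, isotone excess with
`E(S′y) ≤ β₀∕10`; unique solution families.  Along the base orbit `h = S y`: at EVERY depth `m`, `X_m ≥ 0`, `X_{m+1}h_{m+1}² ≤ X_mh_m²`, and
`Σ_{j<J} h_{m+j}²·(e_{m+j} − e_{m+j+1}) ≤ X_mh_m²` for every `J` (row induction from the deep region of (E121b) `exists_base_depth_var`). [folklore] -/
theorem steps_nonneg_gauge_size (hBaff : ∀ u, SeqBox γ u → B u = β₀ + ∑ k ∈ range K, L k * u k) (hL : ∀ k, 0 ≤ L k) (hL0 : L 0 = 0) (hβ : 0 < β₀)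
    (hB' : ∀ u u' : ℕ → ℝ, SeqBox γ u → SeqBox γ u' → ∀ D : ℝ, (∀ j, |u j - u' j| ≤ D) → |B' u - B' u'| ≤ M' * D) (hM' : 0 ≤ M')
    (hexc : ∀ u, SeqBox γ u → B u ≤ B' u)
    (hDmono : ∀ u v : ℕ → ℝ, SeqBox γ u → SeqBox γ v → (∀ j, u j ≤ v j) → B' u - B u ≤ B' v - B v)
    (hS : ∀ p, 0 < p → p ≤ γ → SeqBox γ (S p) ∧ MemFlow B p (S p))
    (huniq : ∀ p, 0 < p → p ≤ γ → ∀ u u' : ℕ → ℝ, SeqBox γ u → SeqBox γ u' → MemFlow B p u → MemFlow B p u' → u = u')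
    (hS' : ∀ p, 0 < p → p ≤ γ → SeqBox γ (S' p) ∧ MemFlow B' p (S' p))
    (huniq' : ∀ p, 0 < p → p ≤ γ → ∀ u u' : ℕ → ℝ, SeqBox γ u → SeqBox γ u' → MemFlow B' p u → MemFlow B' p u' → u = u')
    {y : ℝ} (hy : 0 < y) (hyγ : y ≤ γ) (hEsize : B' (S' y) - B (S' y) ≤ β₀ / 10) :
    ∀ m, 0 ≤ B' (S' (S y m)) - B (S (S y m))
      ∧ (B' (S' (S y (m + 1))) - B (S (S y (m + 1)))) * S y (m + 1) ^ 2 ≤ (B' (S' (S y m)) - B (S (S y m))) * S y m ^ 2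
      ∧ ∀ J, ∑ j ∈ range J, S y (m + j) ^ 2
          * ((B' (S' (S y (m + j))) - B (S' (S y (m + j)))) - (B' (S' (S y (m + j + 1))) - B (S' (S y (m + j + 1)))))
        ≤ (B' (S' (S y m)) - B (S (S y m))) * S y m ^ 2 := by
  obtain ⟨hmono, hlo, hdom, hBmod⟩ := affine_facts hBaff hL hβ
  have hM : 0 ≤ ∑ k ∈ range K, L k := sum_nonneg fun k _ => hL k
  have hh := (hS y hy hyγ).1
  have hf := (hS y hy hyγ).2
  have hpos : ∀ j, 0 < S y j := fun j => (hh j).1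
  -- the deep region
  obtain ⟨N₀, hN₀⟩ := exists_base_depth_var hBaff hL hβ hh hf
  have hXdeep : ∀ m, N₀ ≤ m → 0 ≤ B' (S' (S y m)) - B (S (S y m)) := by
    intro m hm
    have hq := family_mem hS hy hyγ m
    have hsmall := (hN₀ m hm).1.2
    have := effective_le_of_small_pin hBmod hM hβ hlo hexc hDmono hq.1 hq.2 hsmall (hS _ hq.1 hq.2).1 (hS _ hq.1 hq.2).2
      (hS' _ hq.1 hq.2).1 (hS' _ hq.1 hq.2).2
    linarith
  -- P(n): non-negativity, the gauge and the variation bound at every m ≥ n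
  have hP : ∀ d n, N₀ ≤ n + d → ∀ m, n ≤ m → 0 ≤ B' (S' (S y m)) - B (S (S y m))
      ∧ (B' (S' (S y (m + 1))) - B (S (S y (m + 1)))) * S y (m + 1) ^ 2 ≤ (B' (S' (S y m)) - B (S (S y m))) * S y m ^ 2
      ∧ ∀ J, ∑ j ∈ range J, S y (m + j) ^ 2
          * ((B' (S' (S y (m + j))) - B (S' (S y (m + j)))) - (B' (S' (S y (m + j + 1))) - B (S' (S y (m + j + 1)))))
        ≤ (B' (S' (S y m)) - B (S (S y m))) * S y m ^ 2 := by
    intro d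
    induction d with
    | zero =>
      intro n hn m hm
      rw [add_zero] at hn
      have hcmp := cmp_of_steps_nonneg hBaff hL hβ hB' hM' hexc hDmono hS huniq hS' huniq' hy hyγ m fun m' hm' => hXdeep m' (by omega)
      refine ⟨hXdeep m (hn.trans hm), ?_, ?_⟩
      · exact base_gauge_light hBaff hL hL0 hβ hB' hM' hexc hDmono hS huniq hS' huniq' hy hyγ m (hN₀ m (hn.trans hm)).1.1 hcmp
          fun m' hm' => hXdeep m' (by omega)
      · exact var_base hBaff hL hβ hB' hM' hexc hDmono hS huniq hS' huniq' hy hyγ m (hN₀ m (hn.trans hm)).2 hcmp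
    | succ d ih =>
      intro n hn m hm
      have ih' := ih (n + 1) (by omega)
      by_cases hm1 : n + 1 ≤ m
      · exact ih' m hm1
      · have hmn : m = n := by omega
        subst hmn
        have hXb : ∀ m', m + 1 ≤ m' → 0 ≤ B' (S' (S y m')) - B (S (S y m')) := fun m' hm' => (ih' m' hm').1
        have hgb : ∀ m', m + 1 ≤ m' → (B' (S' (S y (m' + 1))) - B (S (S y (m' + 1)))) * S y (m' + 1) ^ 2
            ≤ (B' (S' (S y m')) - B (S (S y m'))) * S y m' ^ 2 := fun m' hm' => (ih' m' hm').2.1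
        have hVb : ∀ m', m + 2 ≤ m' → ∀ J, ∑ j ∈ range J, S y (m' + j) ^ 2
            * ((B' (S' (S y (m' + j))) - B (S' (S y (m' + j)))) - (B' (S' (S y (m' + j + 1))) - B (S' (S y (m' + j + 1)))))
            ≤ (B' (S' (S y m')) - B (S (S y m'))) * S y m' ^ 2 := fun m' hm' => (ih' m' (by omega)).2.2
        have hgs := gauge_step_size hBaff hL hL0 hβ hB' hM' hexc hDmono hS huniq hS' huniq' hy hyγ hEsize m hXb hgb hVb
        have hΔe := (excess_orbit_antitone hBaff hL hβ hB' hM' hexc hDmono hS hS' huniq' hy hyγ m).2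
        have hm2 : 0 < S y m ^ 2 := pow_pos (hpos m) 2
        have hΔe' : 0 ≤ ((B' (S' (S y m)) - B (S' (S y m))) - (B' (S' (S y (m + 1))) - B (S' (S y (m + 1))))) * S y m ^ 2 :=
          mul_nonneg (by linarith) hm2.le
        have hG1 : 0 ≤ (B' (S' (S y (m + 1))) - B (S (S y (m + 1)))) * S y (m + 1) ^ 2 := mul_nonneg (hXb (m + 1) le_rfl) (sq_nonneg _)
        refine ⟨?_, by linarith, ?_⟩
        · have h1 : 0 ≤ (B' (S' (S y m)) - B (S (S y m))) * S y m ^ 2 := by linarith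
          nlinarith
        · intro J
          cases J with
          | zero => simp only [range_zero, sum_empty]; linarith
          | succ J' =>
            rw [sum_range_succ']
            simp only [add_zero]
            have hrest := (ih' (m + 1) le_rfl).2.2 J'
            have e : ∑ j ∈ range J', S y (m + (j + 1)) ^ 2
                * ((B' (S' (S y (m + (j + 1)))) - B (S' (S y (m + (j + 1))))) - (B' (S' (S y (m + (j + 1) + 1))) - B (S' (S y (m + (j + 1) + 1)))))
                = ∑ j ∈ range J', S y (m + 1 + j) ^ 2
                * ((B' (S' (S y (m + 1 + j))) - B (S' (S y (m + 1 + j)))) - (B' (S' (S y (m + 1 + j + 1))) - B (S' (S y (m + 1 + j + 1))))) :=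
              sum_congr rfl fun j _ => by rw [show m + (j + 1) = m + 1 + j by ring]
            rw [e]
            linarith
  intro m
  exact hP N₀ 0 (by omega) m (Nat.zero_le m)

/-! ## §3 Comparison at any steepness for an isotone excess of small size -/

/-- **THE EFFECTIVE β-FUNCTIONS OF `B` AND `B′` ARE ORDERED AT EVERY PIN**, `B(S y) ≤ B′(S′y)` for every `y ∈ ]0,γ]` — affine base of any profile and size, isotone
excess of any steepness with `E ≤ β₀∕10` on the box. [folklore] -/
theorem effective_le_size (hBaff : ∀ u, SeqBox γ u → B u = β₀ + ∑ k ∈ range K, L k * u k) (hL : ∀ k, 0 ≤ L k) (hL0 : L 0 = 0) (hβ : 0 < β₀)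
    (hB' : ∀ u u' : ℕ → ℝ, SeqBox γ u → SeqBox γ u' → ∀ D : ℝ, (∀ j, |u j - u' j| ≤ D) → |B' u - B' u'| ≤ M' * D) (hM' : 0 ≤ M')
    (hexc : ∀ u, SeqBox γ u → B u ≤ B' u)
    (hDmono : ∀ u v : ℕ → ℝ, SeqBox γ u → SeqBox γ v → (∀ j, u j ≤ v j) → B' u - B u ≤ B' v - B v)
    (hEsmall : ∀ u, SeqBox γ u → B' u - B u ≤ β₀ / 10)
    (hS : ∀ p, 0 < p → p ≤ γ → SeqBox γ (S p) ∧ MemFlow B p (S p))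
    (huniq : ∀ p, 0 < p → p ≤ γ → ∀ u u' : ℕ → ℝ, SeqBox γ u → SeqBox γ u' → MemFlow B p u → MemFlow B p u' → u = u')
    (hS' : ∀ p, 0 < p → p ≤ γ → SeqBox γ (S' p) ∧ MemFlow B' p (S' p))
    (huniq' : ∀ p, 0 < p → p ≤ γ → ∀ u u' : ℕ → ℝ, SeqBox γ u → SeqBox γ u' → MemFlow B' p u → MemFlow B' p u' → u = u') :
    ∀ y, 0 < y → y ≤ γ → B (S y) ≤ B' (S' y) := by
  intro y hy hyγ
  have := (steps_nonneg_gauge_size hBaff hL hL0 hβ hB' hM' hexc hDmono hS huniq hS' huniq' hy hyγ (hEsmall _ (hS' y hy hyγ).1) 0).1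
  rw [family_zero hS hy hyγ] at this
  linarith

/-- **COMPARISON AT ANY STEEPNESS FOR EVERY ISOTONE EXCESS OF SMALL SIZE, family-free form.**  `B u = β₀ + Σ_{k<K} L_k·u_k` on the box ]0,γ] with `β₀ > 0`, `L ≥ 0`,
`L_0 = 0` — the profile, the range `K` and ALL SIZES ARBITRARY (no light-row condition); `B′ ≥ B` on the box with a modulus `M′ ≥ 0`, the excess `B′ − B` ISOTONE and
of SIZE `≤ β₀∕10` on the box (NO modulus or steepness condition on the excess); `h`, `h′` ANY box solutions of `B`, `B′` from one pin `p ∈ ]0,γ]`.  Then `h′ ≤ h` at EVERY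
scale.  ((E39) existence and (E43b) uniqueness at any size, `effective_le_size`, (E49k) `family_le_of_orbit`.) [folklore] -/
theorem le_of_small_isotone_excess {p : ℝ} {h h' : ℕ → ℝ} (hBaff : ∀ u, SeqBox γ u → B u = β₀ + ∑ k ∈ range K, L k * u k) (hL : ∀ k, 0 ≤ L k)
    (hL0 : L 0 = 0) (hβ : 0 < β₀)
    (hB' : ∀ u u' : ℕ → ℝ, SeqBox γ u → SeqBox γ u' → ∀ D : ℝ, (∀ j, |u j - u' j| ≤ D) → |B' u - B' u'| ≤ M' * D) (hM' : 0 ≤ M')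
    (hexc : ∀ u, SeqBox γ u → B u ≤ B' u)
    (hDmono : ∀ u v : ℕ → ℝ, SeqBox γ u → SeqBox γ v → (∀ j, u j ≤ v j) → B' u - B u ≤ B' v - B v)
    (hEsmall : ∀ u, SeqBox γ u → B' u - B u ≤ β₀ / 10)
    (hp : 0 < p) (hpγ : p ≤ γ) (hh : SeqBox γ h) (hf : MemFlow B p h) (hh' : SeqBox γ h') (hf' : MemFlow B' p h') (j : ℕ) :
    h' j ≤ h j := by
  obtain ⟨hmono', hlo'⟩ := excess_facts hBaff hL hβ hexc hDmono
  obtain ⟨hmono, hlo, _, hBmod⟩ := affine_facts hBaff hL hβ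
  have hM : 0 ≤ ∑ k ∈ range K, L k := sum_nonneg fun k _ => hL k
  have hγ : 0 < γ := hp.trans_le hpγ
  have hex : ∀ q : ℝ, 0 < q → q ≤ γ → ∃ k : ℕ → ℝ, SeqBox γ k ∧ MemFlow B q k := fun q hq hqγ => exists_memFlow_zm hBmod hM hq hqγ hβ hlo
  have hex' : ∀ q : ℝ, 0 < q → q ≤ γ → ∃ k : ℕ → ℝ, SeqBox γ k ∧ MemFlow B' q k := fun q hq hqγ => exists_memFlow_zm hB' hM' hq hqγ hβ hlo'
  choose! S hSb hSf using hex
  choose! S' hS'b hS'f using hex'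
  have hS : ∀ q, 0 < q → q ≤ γ → SeqBox γ (S q) ∧ MemFlow B q (S q) := fun q hq hqγ => ⟨hSb q hq hqγ, hSf q hq hqγ⟩
  have hS' : ∀ q, 0 < q → q ≤ γ → SeqBox γ (S' q) ∧ MemFlow B' q (S' q) := fun q hq hqγ => ⟨hS'b q hq hqγ, hS'f q hq hqγ⟩
  have huniq : ∀ q, 0 < q → q ≤ γ → ∀ u u' : ℕ → ℝ, SeqBox γ u → SeqBox γ u' → MemFlow B q u → MemFlow B q u' → u = u' :=
    fun q hq _ u u' hu hu' hfu hfu' => memFlow_unique_of_monotone_zm hmono hBmod hM hq hβ hlo hu hu' hfu hfu'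
  have huniq' : ∀ q, 0 < q → q ≤ γ → ∀ u u' : ℕ → ℝ, SeqBox γ u → SeqBox γ u' → MemFlow B' q u → MemFlow B' q u' → u = u' :=
    fun q hq _ u u' hu hu' hfu hfu' => memFlow_unique_of_monotone_zm hmono' hB' hM' hq hβ hlo' hu hu' hfu hfu'
  have e : h = S p := huniq p hp hpγ _ _ hh (hS p hp hpγ).1 hf (hS p hp hpγ).2
  have e' : h' = S' p := huniq' p hp hpγ _ _ hh' (hS' p hp hpγ).1 hf' (hS' p hp hpγ).2
  rw [e, e']
  exact family_le_of_orbit hβ hγ hB' hM' hlo' hS huniq hS' huniq' ⟨hp, hpγ⟩ (fun i _ =>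
    effective_le_size hBaff hL hL0 hβ hB' hM' hexc hDmono hEsmall hS huniq hS' huniq' _ (family_mem hS hp hpγ i).1 (family_mem hS hp hpγ i).2) j

end Summit.QuantumFields.BalabanUV.Beta.EriceRemainderEnclosureHistoryAutonomyComparisonNonlinearSize

end
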